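import Summits.KontsevichZagierPeriods.KontsevichZagierPeriods.Theorems.SoloBlindTriplPrep
import Literature.NumberTheory.Transcendental.FischlerRivoalCorollary1Reduction
import HarnessLib

/-!
# The tetrahedral descent of `B(1/12,1/4)`, I: functions and identities

The level-12 Beta values `B(1/12,1/4)`, `B(5/12,1/4)` (orbits `{1,3,8}`, `{3,4,5}` of
`(ℤ/12)³ ∋ (a,b,c)`, `a+b+c ≡ 0`) are NOT linked to any lower-level value by the multiplication
formulas (the Hodge class `(1,8,9,6) ∈ 𝔅²₁₂` of Aoki–Shioda is exceptional, i.e. not standard).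
They are linked inside the Kontsevich–Zagier rules by the following one-dimensional chain, whose
mechanism is the Klein four-group of Möbius symmetries of the branch set `{0, 1, ζ₃, ζ̄₃}` of
`v(1 - v³)`:

* `t = v³`: `t^{1/12-1}(1-t)^{1/4-1} dt = 3 (v(1-v³))^{-3/4} dv =: G(v) dv` on `(0,1)`, and
  `t^{5/12-1}(1-t)^{-3/4} dt = v·G(v) dv`;
* the real Möbius involution-normalising map `v = μ(u) = ((√3+1)u + √3-1)/(2(1-u))`, an
  increasing bijection `(-u₁,u₁) → (0,1)`, `u₁ = 2 - √3`, satisfies the KEY IDENTITY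
  `μ(1-μ³)(1-u)⁴ = κ (u₁²-u²)(1+u²)`, `κ = 3(3+2√3)/4`, whence
  `G(μ(u)) μ'(u) = C₀ (1-u) E(u)`, `E(u) = ((u₁²-u²)(1+u²))^{-3/4}` EVEN, `C₀ = 3√3 κ^{-3/4}`,
  and `μ G(μ) μ' = C₀ (√3+1)/2 · (u+u₁) E(u)`;
* evenness of `E` (the involution `u ↦ -u`, i.e. the element of the four-group exchanging
  `0 ↔ 1`, `ζ₃ ↔ ζ̄₃`) kills the odd parts: both values become algebraic multiples of
  `J = ∫₀^{u₁} E`;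
* `s = u²` and the Möbius map `s = ν(x) = u₁² x/(1 + u₁²(1-x))` (sending the third root `-1` of
  `(u₁²-s)(1+s)` to `∞`) turn `J` into `(1/(4u₁)) B(1/2,1/4)`.

Consequences (performed in `SoloBlindTetra`): `β(5/12,1/4) = ((√3-1)/2) • β(1/12,1/4)` and
`β(1/12,1/4) = (C₀/(2u₁)) • β(1/2,1/4)`, so the level-12 orbits `{3,4,5}`, `{1,3,8}` merge with
`{3,3,6} ∋ B(1/4,1/4)`.

This file: the constants (all in `K₀ = ℚ̄ ∩ ℝ`), the maps `μ`, `v³`, `u²`, `ν` as bijections,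
and the four pull-back identities.

References: N. Aoki, *Some new algebraic cycles on Fermat varieties*, J. Math. Soc. Japan 39
(1987) (exceptional classes); M. Kontsevich, D. Zagier, *Periods* (2001), §1.2.
-/

noncomputable section

open Set MeasureTheory MvPolynomial

namespace Summit.KontsevichZagierPeriods.KontsevichZagierPeriods.Theorems

namespace SoloBlind

/-! ## Constants -/

/-- `r3 = √3`. -/
def r3 : ℝ := Real.sqrt 3

/-- `r3² = 3`. -/
theorem r3_sq : r3 ^ 2 = 3 := Real.sq_sqrt (by norm_num)

/-- `1 < √3`. -/
theorem one_lt_r3 : 1 < r3 := by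
  have h : Real.sqrt 1 < Real.sqrt 3 := Real.sqrt_lt_sqrt (by norm_num) (by norm_num)
  simpa [r3] using h

/-- `√3 < 2`. -/
theorem r3_lt_two : r3 < 2 := by
  have h : Real.sqrt 3 < Real.sqrt 4 := Real.sqrt_lt_sqrt (by norm_num) (by norm_num)
  have h4 : Real.sqrt 4 = 2 := by
    rw [show (4:ℝ) = 2 ^ 2 by norm_num]
    exact Real.sqrt_sq (by norm_num)
  simpa [r3, h4] using h

/-- `0 < √3`. -/
theorem r3_pos : 0 < r3 := one_pos.trans one_lt_r3

/-- `√3` is algebraic. -/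
theorem isAlgebraic_r3 : IsAlgebraic ℚ r3 :=
  IsAlgebraic.of_pow two_pos (by rw [r3_sq]; simpa using isAlgebraic_rat ℚ (A := ℝ) 3)

/-- `√3` as an element of `K₀ = ℚ̄ ∩ ℝ`. -/
def r3K : K₀ := ⟨r3, mem_K₀_iff.mpr isAlgebraic_r3⟩

/-- A real number given by a `K₀`-expression is algebraic. -/
theorem isAlgebraic_of_K₀ (c : K₀) {x : ℝ} (h : (c : ℝ) = x) : IsAlgebraic ℚ x :=
  h ▸ mem_K₀_iff.mp c.2

/-- `u₁ = 2 - √3` (`= tan(π/12)`): the ends `±u₁` of the symmetric interval are the preimages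
of `0` and `1` under `μ`. -/
def tU : ℝ := 2 - r3

/-- `0 < u₁`. -/
theorem tU_pos : 0 < tU := by unfold tU; linarith [r3_lt_two]

/-- `u₁ < 1`. -/
theorem tU_lt_one : tU < 1 := by unfold tU; linarith [one_lt_r3]

/-- `u₁` is algebraic. -/
theorem isAlgebraic_tU : IsAlgebraic ℚ tU :=
  isAlgebraic_of_K₀ (2 - r3K) (by rw [AddSubgroupClass.coe_sub]; rfl)

/-- `-u₁` is algebraic. -/
theorem isAlgebraic_neg_tU : IsAlgebraic ℚ (-tU) :=
  isAlgebraic_of_K₀ (-(2 - r3K)) (by rw [NegMemClass.coe_neg, AddSubgroupClass.coe_sub]; rfl)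

/-- `u₁²` is algebraic. -/
theorem isAlgebraic_tU_sq : IsAlgebraic ℚ (tU ^ 2) :=
  isAlgebraic_of_K₀ ((2 - r3K) ^ 2) (by rw [SubmonoidClass.coe_pow, AddSubgroupClass.coe_sub]; rfl)

/-- `1 + u₁² = 4u₁`. -/
theorem one_add_tU_sq : 1 + tU ^ 2 = 4 * tU := by
  have h3 := r3_sq
  unfold tU
  linear_combination h3

/-- `u₁ (2 + √3) = 1`. -/
theorem tU_mul : tU * (2 + r3) = 1 := by
  have h3 := r3_sq
  unfold tU
  linear_combination -h3

/-- `κ = 3(3+2√3)/4`, the constant of the key identity. -/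
def tKappa : ℝ := 3 * (3 + 2 * r3) / 4

/-- `0 < κ`. -/
theorem tKappa_pos : 0 < tKappa := by unfold tKappa; linarith [r3_pos]

/-- `κ` is algebraic. -/
theorem isAlgebraic_tKappa : IsAlgebraic ℚ tKappa :=
  isAlgebraic_of_K₀ (3 * (3 + 2 * r3K) / 4) (by push_cast; rfl)

/-- `κ = 6(√3+1)(√3+3)/16`. -/
theorem tKappa_eq : 6 * (r3 + 1) * (r3 + 3) / 16 = tKappa := by
  have h3 := r3_sq
  unfold tKappa
  linear_combination (6 / 16 : ℝ) * h3

/-- `κ^{-3/4}` is algebraic. -/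
theorem isAlgebraic_tKappa_rpow : IsAlgebraic ℚ (tKappa ^ (-(3 / 4 : ℝ))) := by
  have h := Literature.NumberTheory.Transcendental.isAlgebraic_rpow_ratCast isAlgebraic_tKappa
    tKappa_pos (-(3 / 4))
  push_cast at h
  exact h

/-- `C₀ = 3√3 κ^{-3/4}`, the constant of the pull-back along `μ`. -/
def tC0 : ℝ := 3 * r3 * tKappa ^ (-(3 / 4 : ℝ))

/-- `0 < C₀`. -/
theorem tC0_pos : 0 < tC0 := by
  unfold tC0
  exact mul_pos (mul_pos three_pos r3_pos) (Real.rpow_pos_of_pos tKappa_pos _)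

/-- `C₀` is algebraic. -/
theorem isAlgebraic_tC0 : IsAlgebraic ℚ tC0 :=
  isAlgebraic_of_K₀ (3 * r3K * ⟨_, mem_K₀_iff.mpr isAlgebraic_tKappa_rpow⟩) (by push_cast; rfl)

/-! ## The functions -/

/-- The Möbius map `μ(u) = ((√3+1)u + √3-1)/(2(1-u))`. -/
def tetMu (u : ℝ) : ℝ := ((r3 + 1) * u + (r3 - 1)) / (2 * (1 - u))

/-- `μ'(u) = √3/(1-u)²`. -/
def tetMu' (u : ℝ) : ℝ := r3 / (1 - u) ^ 2

/-- `P(u) = (u₁²-u²)(1+u²)`. -/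
def tetP (u : ℝ) : ℝ := (tU ^ 2 - u ^ 2) * (1 + u ^ 2)

/-- `E(u) = P(u)^{-3/4}`, the even integrand. -/
def tetE (u : ℝ) : ℝ := tetP u ^ (-(3 / 4 : ℝ))

/-- `G(v) = 3 (v(1-v³))^{-3/4}`, the pull-back of the `B(1/12,1/4)` integrand along `t = v³`. -/
def tetG (v : ℝ) : ℝ := 3 * (v * (1 - v ^ 3)) ^ (-(3 / 4 : ℝ))

/-- `H(u) = C₀ (1-u) E(u)`, the pull-back of `G` along `μ`. -/
def tetH (u : ℝ) : ℝ := tC0 * ((1 - u) * tetE u)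

/-- `H₁(u) = C₀ (√3+1)/2 · (u+u₁) E(u)`, the pull-back of `v G(v)` along `μ`. -/
def tetH₁ (u : ℝ) : ℝ := tC0 * ((r3 + 1) / 2 * ((u + tU) * tetE u))

/-! ## Algebra modulo `√3² = 3` -/

/-- The numerator of `μ` factors: `(√3+1)u + √3 - 1 = (√3+1)(u+u₁)`. -/
theorem tet_num_eq (u : ℝ) : (r3 + 1) * u + (r3 - 1) = (r3 + 1) * (u + tU) := by
  have h3 := r3_sq
  unfold tU
  linear_combination h3

/-- `2(1-u) - ((√3+1)u + √3 - 1) = (√3+3)(u₁-u)` (so `μ < 1 ⟺ u < u₁`). -/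
theorem tet_den_sub_num (u : ℝ) :
    2 * (1 - u) - ((r3 + 1) * u + (r3 - 1)) = (r3 + 3) * (tU - u) := by
  have h3 := r3_sq
  unfold tU
  linear_combination h3

/-- **The key identity** `N((2D)³ - N³) = 6(√3+1)(√3+3) P(u)` (`N` the numerator, `D = 1-u`). -/
theorem tet_key (u : ℝ) :
    ((r3 + 1) * u + (r3 - 1)) * ((2 * (1 - u)) ^ 3 - ((r3 + 1) * u + (r3 - 1)) ^ 3)
      = 6 * (r3 + 1) * (r3 + 3) * tetP u := by
  have h3 := r3_sq
  unfold tetP tU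
  linear_combination (27 + 4 * r3 - 7 * r3 ^ 2 - 12 * u + 8 * u * r3 - 4 * u * r3 ^ 2
    + 36 * u ^ 2 - 12 * u ^ 2 * r3 ^ 2 - 12 * u ^ 3 - 8 * u ^ 3 * r3 - 4 * u ^ 3 * r3 ^ 2
    - 3 * u ^ 4 - 4 * u ^ 4 * r3 - u ^ 4 * r3 ^ 2) * h3

/-- `P(u) > 0` for `|u| < u₁`. -/
theorem tetP_pos {u : ℝ} (hu : u ∈ Ioo (-tU) tU) : 0 < tetP u := by
  unfold tetP
  have h1 : 0 < tU ^ 2 - u ^ 2 := by nlinarith [hu.1, hu.2]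
  positivity

/-- `P` is even. -/
theorem tetP_neg (u : ℝ) : tetP (-u) = tetP u := by simp [tetP]

/-- `E` is even. -/
theorem tetE_neg (u : ℝ) : tetE (-u) = tetE u := by simp [tetE, tetP_neg]

/-- `E(u) > 0` for `|u| < u₁`. -/
theorem tetE_pos {u : ℝ} (hu : u ∈ Ioo (-tU) tU) : 0 < tetE u :=
  Real.rpow_pos_of_pos (tetP_pos hu) _

/-- `μ(1-μ³) = κ P(u)/(1-u)⁴` for `u ≠ 1`. -/
theorem tetMu_mul {u : ℝ} (hu : u ≠ 1) :
    tetMu u * (1 - tetMu u ^ 3) = tKappa * tetP u / (1 - u) ^ 4 := by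
  have hD : (1 - u) ≠ 0 := sub_ne_zero.mpr (Ne.symm hu)
  have e1 : tetMu u * (1 - tetMu u ^ 3) = ((r3 + 1) * u + (r3 - 1)) *
      ((2 * (1 - u)) ^ 3 - ((r3 + 1) * u + (r3 - 1)) ^ 3) / (2 * (1 - u)) ^ 4 := by
    unfold tetMu
    field_simp
  rw [e1, tet_key, ← tKappa_eq]
  field_simp
  ring

/-! ## `μ` as a bijection `(-u₁,u₁) → (0,1)` -/

/-- `μ` maps `(-u₁,u₁)` into `(0,1)`. -/
theorem tetMu_mem {u : ℝ} (hu : u ∈ Ioo (-tU) tU) : tetMu u ∈ Ioo (0:ℝ) 1 := by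
  have hD : 0 < 2 * (1 - u) := by linarith [hu.2, tU_lt_one]
  have hN : 0 < (r3 + 1) * u + (r3 - 1) := by
    rw [tet_num_eq]
    exact mul_pos (by linarith [r3_pos]) (by linarith [hu.1])
  refine ⟨div_pos hN hD, (div_lt_one hD).mpr ?_⟩
  have h := tet_den_sub_num u
  have h2 : 0 < (r3 + 3) * (tU - u) := mul_pos (by linarith [r3_pos]) (by linarith [hu.2])
  linarith

/-- `μ` is differentiable away from `1`, with derivative `√3/(1-u)²`. -/
theorem hasDerivAt_tetMu {u : ℝ} (hu : u ≠ 1) : HasDerivAt tetMu (tetMu' u) u := by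
  have hD : 2 * (1 - u) ≠ 0 := mul_ne_zero two_ne_zero (sub_ne_zero.mpr (Ne.symm hu))
  have h1 : HasDerivAt (fun y => (r3 + 1) * y + (r3 - 1)) (r3 + 1) u := by
    simpa using ((hasDerivAt_id u).const_mul (r3 + 1)).add_const (r3 - 1)
  have h2 : HasDerivAt (fun y => 2 * (1 - y)) (-2) u := by
    simpa using ((hasDerivAt_id u).const_sub 1).const_mul (2:ℝ)
  have h := h1.div h2 hD
  refine h.congr_deriv ?_
  unfold tetMu'
  field_simp
  ring

/-- `μ' > 0` away from `1`. -/
theorem tetMu'_pos {u : ℝ} (hu : u ≠ 1) : 0 < tetMu' u :=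
  div_pos r3_pos (pow_pos' hu)
where
  /-- `(1-u)² > 0` for `u ≠ 1`. -/
  pow_pos' (hu : u ≠ 1) : 0 < (1 - u) ^ 2 := by positivity [sub_ne_zero.mpr (Ne.symm hu)]

/-- `μ` is injective away from `1` (it is a Möbius map). -/
theorem injOn_tetMu : InjOn tetMu (Ioo (-tU) tU) := by
  intro x hx y hy h
  have hx1 : (1 - x) ≠ 0 := by
    have : x < 1 := hx.2.trans tU_lt_one
    exact sub_ne_zero.mpr (ne_of_gt this)
  have hy1 : (1 - y) ≠ 0 := by
    have : y < 1 := hy.2.trans tU_lt_one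
    exact sub_ne_zero.mpr (ne_of_gt this)
  unfold tetMu at h
  rw [div_eq_div_iff (mul_ne_zero two_ne_zero hx1) (mul_ne_zero two_ne_zero hy1)] at h
  have h' : (x - y) * (4 * r3) = 0 := by linear_combination h
  rcases mul_eq_zero.mp h' with h0 | h0
  · exact sub_eq_zero.mp h0
  · linarith [r3_pos]

/-- `μ` maps `(-u₁,u₁)` ONTO `(0,1)`: the inverse Möbius map is `u = (2v-√3+1)/(2v+√3+1)`. -/
theorem image_tetMu : Ioo (0:ℝ) 1 = tetMu '' Ioo (-tU) tU := by
  have h3 := r3_sq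
  ext v
  constructor
  · rintro ⟨hv0, hv1⟩
    have hb : 0 < 2 * v + (r3 + 1) := by linarith [r3_pos]
    refine ⟨(2 * v - (r3 - 1)) / (2 * v + (r3 + 1)), ⟨?_, ?_⟩, ?_⟩
    · rw [lt_div_iff₀ hb]
      have e : (2 * v - (r3 - 1)) + tU * (2 * v + (r3 + 1)) = 2 * v * (3 - r3) := by
        unfold tU; linear_combination (-1:ℝ) * h3
      nlinarith [r3_lt_two, e]
    · rw [div_lt_iff₀ hb]
      have e : tU * (2 * v + (r3 + 1)) - (2 * v - (r3 - 1)) = 2 * (r3 - 1) * (1 - v) := by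
        unfold tU; linear_combination (-1:ℝ) * h3
      nlinarith [one_lt_r3, e]
    · have hD : 2 * (1 - (2 * v - (r3 - 1)) / (2 * v + (r3 + 1))) ≠ 0 := by
        rw [show 1 - (2 * v - (r3 - 1)) / (2 * v + (r3 + 1)) = 2 * r3 / (2 * v + (r3 + 1)) by
          field_simp; ring]
        positivity [r3_pos]
      unfold tetMu
      rw [div_eq_iff hD]
      field_simp
      ring
  · rintro ⟨u, hu, rfl⟩
    exact tetMu_mem hu

/-! ## The cube substitution `t = v³` -/

/-- `(v³)^{1/12-1} = v^{-3/4}/v²` for `v > 0`. -/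
theorem tet_cube_rpow {v : ℝ} (hv : 0 < v) :
    (v ^ 3) ^ (((1 / 12 : ℚ) : ℝ) - 1) = v ^ (-(3 / 4 : ℝ)) * (v ^ 2)⁻¹ := by
  rw [← Real.rpow_natCast v 3, ← Real.rpow_mul hv.le, ← Real.rpow_natCast v 2,
    ← Real.rpow_neg hv.le, ← Real.rpow_add hv]
  norm_num

/-- `(v³)^{5/12-1} = v · v^{-3/4}/v²` for `v > 0`. -/
theorem tet_cube_rpow₁ {v : ℝ} (hv : 0 < v) :
    (v ^ 3) ^ (((5 / 12 : ℚ) : ℝ) - 1) = v * v ^ (-(3 / 4 : ℝ)) * (v ^ 2)⁻¹ := by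
  have e : v * v ^ (-(3 / 4 : ℝ)) = v ^ (1 / 4 : ℝ) := by
    rw [show (1 / 4 : ℝ) = 1 + -(3 / 4) by norm_num, Real.rpow_add hv, Real.rpow_one]
  rw [e, ← Real.rpow_natCast v 3, ← Real.rpow_mul hv.le, ← Real.rpow_natCast v 2,
    ← Real.rpow_neg hv.le, ← Real.rpow_add hv]
  norm_num

/-- **Pull-back along `t = v³`:** `G(v) = t^{1/12-1}(1-t)^{1/4-1}|3v²|` on `(0,1)`. -/
theorem tet_cube {v : ℝ} (hv : v ∈ Ioo (0:ℝ) 1) :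
    tetG v = betaFun (1 / 12) (1 / 4) (v ^ 3) * |3 * v ^ 2| := by
  have hv0 := hv.1
  have hv3 : 0 < 1 - v ^ 3 := by
    have : v ^ 3 < 1 := by
      calc v ^ 3 < 1 ^ 3 := pow_lt_pow_left₀ hv.2 hv0.le (by norm_num)
        _ = 1 := by norm_num
    linarith
  rw [betaFun, tet_cube_rpow hv0, abs_of_pos (by positivity), tetG, Real.mul_rpow hv0.le hv3.le,
    show (((1 / 4 : ℚ) : ℝ) - 1) = -(3 / 4 : ℝ) by norm_num]
  field_simp

/-- **Pull-back along `t = v³`, second value:** `v G(v) = t^{5/12-1}(1-t)^{1/4-1}|3v²|`. -/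
theorem tet_cube₁ {v : ℝ} (hv : v ∈ Ioo (0:ℝ) 1) :
    v * tetG v = betaFun (5 / 12) (1 / 4) (v ^ 3) * |3 * v ^ 2| := by
  have hv0 := hv.1
  have hv3 : 0 < 1 - v ^ 3 := by
    have : v ^ 3 < 1 := by
      calc v ^ 3 < 1 ^ 3 := pow_lt_pow_left₀ hv.2 hv0.le (by norm_num)
        _ = 1 := by norm_num
    linarith
  rw [betaFun, tet_cube_rpow₁ hv0, abs_of_pos (by positivity), tetG, Real.mul_rpow hv0.le hv3.le,
    show (((1 / 4 : ℚ) : ℝ) - 1) = -(3 / 4 : ℝ) by norm_num]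
  field_simp

/-- The cube map is injective on `(0,1)`. -/
theorem injOn_cube : InjOn (fun v : ℝ => v ^ 3) (Ioo (0:ℝ) 1) := fun x hx y hy h =>
  (pow_left_strictMonoOn₀ (by norm_num : (3:ℕ) ≠ 0)).injOn hx.1.le hy.1.le h

/-- The cube map sends `(0,1)` onto `(0,1)`. -/
theorem image_cube : Ioo (0:ℝ) 1 = (fun v : ℝ => v ^ 3) '' Ioo (0:ℝ) 1 := by
  ext t
  constructor
  · rintro ⟨h0, h1⟩
    refine ⟨t ^ (1 / 3 : ℝ), ⟨Real.rpow_pos_of_pos h0 _,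
      Real.rpow_lt_one h0.le h1 (by norm_num)⟩, ?_⟩
    show (t ^ (1 / 3 : ℝ)) ^ 3 = t
    rw [← Real.rpow_natCast, ← Real.rpow_mul h0.le]
    norm_num
  · rintro ⟨v, ⟨h0, h1⟩, rfl⟩
    refine ⟨by positivity, ?_⟩
    calc v ^ 3 < 1 ^ 3 := pow_lt_pow_left₀ h1 h0.le (by norm_num)
      _ = 1 := by norm_num

/-- The derivative of the cube map. -/
theorem hasDerivAt_cube (v : ℝ) : HasDerivAt (fun v : ℝ => v ^ 3) (3 * v ^ 2) v := by
  simpa using hasDerivAt_pow 3 v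

end SoloBlind

end Summit.KontsevichZagierPeriods.KontsevichZagierPeriods.Theorems
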